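import Summits.HodgeConjecture.HodgeConjecture.Theorems.Ring2WeilCoverageNormTableC
import HarnessLib

/-!
# Weil-type family coverage — THEOREM Z (the tower law), the product-action class law, and the bidegree bound (ring2-b02, gen 68)

research route conditional on HC_CM; not a corollary; Q11.4-sentence-2 already refuted in dim ≥ 3.

Ring 2, WEIL-TYPE FAMILY-COVERAGE CENSUS (`HOME/WEIL-FAMILY-COVERAGE.md` `## b02 (g = 6)`, block b02.28, owner ring2-b02).
Block b02.28 closes the «imprimitive natural windows» (`S_a ≀ S_b`, `S_a × S_b`) for the ten residual sixfold rows.  This file checks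
in the kernel the finite algebra and arithmetic the block's theorems rest on (full text: `weilcov/g68/doc/theoremZ.md`):

* §1 **THEOREM Z (tower law), the algebra.**  In the norm-residue group `ℚˣ/Nm(Kˣ)` every class is an involution; from
  `cl(U^{L′}) = cl(U^{L})·cl(B)` with `cl(U^{M}) = [|M|·u]^{r(C̃/M)}` (ring2-b04's LEMMA B + LEMMA C′) one gets
  `cl(B) = [L:L′]^{r}·[|L′|u]^{m}`, `= [L:L′]^{r}` for even `m`: THEOREM S7 without 2-transitivity, S8 without cyclicity
  (`towerLaw`, `towerLaw_even`).  The additive (`𝔽₂`-linear) form of the four-term bookkeeping of the PRODUCT ACTION gives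
  COROLLARY Z2 `cl(B_V) = [a]^{m_b}[b]^{m_a}[|P|u]^{m_V}` (`productAction_class`).
* §2 **PARITY LAW.**  The number of odd parts of a cycle type of `S_a` has the parity of `a` (`length_filter_odd_mod_two`); with
  `Fix(2B, σ) = cyc σ + e(σ) − 1` this is `m_a ≡ a − 1 (mod 2)`: the class of a product-action sixfold of `GL₂(3)` is
  `[a]^{[b even]}·[b]^{[a even]}`.
* §3 **THEOREM P, the inequalities.**  (L4′) `b·μ ≤ S − 2 + 2g`, `S ≤ K/2`, `K = m_a + m_b + 11 − 4g` ⟹ `b·μ ≤ (m_a + m_b + 7)/2`;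
  with `1 + m_a ≤ 12μ + ½` (Riemann–Hurwitz for the `GL₂(3)`-cover `Y_R → X_a` and `2f·r ≤ 2g`) ⟹ `b(m_a + ½) ≤ 6(m_a + m_b + 7)`
  (`bidegree_bound`); `m_a = 1 ⟹ a ≤ 24` (`side_le_24_of_m_eq_one`); the class-`[b]` case `b ≥ 91` forces `a ≤ 8` (`classB_case_a_le_8`);
  the block-size door of COROLLARY Z1 needs `91 ∣ a` etc. with `a` in the reach sets (`≤ 81`, `≤ 92`, `≤ 16`), which is empty
  (`no_residual_blocksize`).
* §4 the residual row keys this concerns, by name (tree, not restated): `sixfold_sqrtNeg2_neg91_ne_split` and its companions (TableC).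

Nothing in this file is a statement about Hodge classes; `HC_CM` is used nowhere; no `def`, no named fact.
References: [cite: vanGeemen1994HodgeAV, 5.2 and (5.4.1)]; [cite: Serre1973, Ch. III §1].
-/

noncomputable section

set_option linter.dupNamespace false

namespace Summit.HodgeConjecture.HodgeConjecture.Ring2.WeilCoverage

namespace TowerLaw

/-! ### §1 THEOREM Z — the algebra in an elementary abelian 2-group (`ℚˣ/Nm(Kˣ)`) -/

/-- In a commutative group in which every element squares to `1`, every element is its own inverse.
research route conditional on HC_CM; not a corollary; Q11.4-sentence-2 already refuted in dim ≥ 3. [folklore] -/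
theorem inv_eq_self_of_sq {G : Type*} [CommGroup G] (h2 : ∀ g : G, g * g = 1) (g : G) : g⁻¹ = g :=
  inv_eq_of_mul_eq_one_right (h2 g)

/-- Even powers vanish in an elementary abelian 2-group.
research route conditional on HC_CM; not a corollary; Q11.4-sentence-2 already refuted in dim ≥ 3. [folklore] -/
theorem pow_even_eq_one {G : Type*} [CommGroup G] (h2 : ∀ g : G, g * g = 1) (g : G) {m : ℕ} (hm : Even m) :
    g ^ m = 1 := by
  obtain ⟨k, rfl⟩ := hm
  rw [← two_mul, pow_mul, pow_two, h2, one_pow]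

/-- **THEOREM Z (tower law), the algebraic step.**  With `x = cl(U^{L′}) = (l′u)^{r+m}`, `y = cl(U^{L}) = (lu)^{r}` and
`x = y·z` (orthogonal decomposition `U^{L′} = U^{L} ⊕ B`, `z = cl(B)`), in the norm-residue group (exponent 2):
`z = (l′·l)^{r}·(l′u)^{m}` — i.e. `cl(B) = [|L′||L|]^{r}[|L′|u]^{m} = [L:L′]^{r}[|L′|u]^{m}` since `|L′||L| ≡ [L:L′]` mod squares.
research route conditional on HC_CM; not a corollary; Q11.4-sentence-2 already refuted in dim ≥ 3. [cite: vanGeemen1994HodgeAV, (5.4.1)] -/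
theorem towerLaw {G : Type*} [CommGroup G] (h2 : ∀ g : G, g * g = 1) {l l' u z : G} {r m : ℕ}
    (h : (l' * u) ^ (r + m) = (l * u) ^ r * z) : z = (l' * l) ^ r * (l' * u) ^ m := by
  have hz : z = (l * u) ^ r * (l' * u) ^ (r + m) := by
    have hsq : (l * u) ^ r * (l * u) ^ r = 1 := by rw [← mul_pow, h2, one_pow]
    calc z = ((l * u) ^ r * (l * u) ^ r) * z := by rw [hsq, one_mul]
      _ = (l * u) ^ r * ((l * u) ^ r * z) := by rw [mul_assoc]
      _ = (l * u) ^ r * (l' * u) ^ (r + m) := by rw [← h]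
  rw [hz, pow_add, ← mul_assoc, ← mul_pow]
  congr 1
  rw [mul_mul_mul_comm, mul_comm l l', h2 u, mul_one]

/-- **THEOREM Z for a Weil-type (even-dimensional) new part:** `cl(B) = [L:L′]^{r(C̃/L)}` — the class of the RELATIVE INDEX, for every
pair of subgroups `L′ ≤ L ≤ G₂` and every carrier with LEMMA C′ (COROLLARY Z1: a block-irreducible relative piece of an imprimitive
permutation factor has the class of its relative block size).
research route conditional on HC_CM; not a corollary; Q11.4-sentence-2 already refuted in dim ≥ 3. [cite: vanGeemen1994HodgeAV, (5.4.1)] -/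
theorem towerLaw_even {G : Type*} [CommGroup G] (h2 : ∀ g : G, g * g = 1) {l l' u z : G} {r m : ℕ} (hm : Even m)
    (h : (l' * u) ^ (r + m) = (l * u) ^ r * z) : z = (l' * l) ^ r := by
  rw [towerLaw h2 h, pow_even_eq_one h2 _ hm, mul_one]

/-- **COROLLARY Z2 (product action), the `𝔽₂`-linear bookkeeping**, written additively (`M` = the norm-residue group, `x + x = 0`):
from `cl(U^{P}) = cl(U^{G₂}) + cl(A) + cl(B′) + cl(B_V)` and the tower law for the row / column stabilisers
(`|G₂| = ab|P|`, `|L_R| = b|P|`, `|L_C| = a|P|`, logarithmically `gG = ga + gb + gP` etc.) one gets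
`cl(B_V) = m_b·[a] + m_a·[b] + m_V·([|P|] + u)`.
research route conditional on HC_CM; not a corollary; Q11.4-sentence-2 already refuted in dim ≥ 3. [cite: vanGeemen1994HodgeAV, (5.4.1)] -/
theorem productAction_class {M : Type*} [AddCommGroup M] (h2 : ∀ x : M, x + x = 0)
    (ga gb gP u cA cB cV : M) (r1 ma mb mV : ℤ)
    (hP : (r1 + ma + mb + mV) • (gP + u) = r1 • (ga + gb + gP + u) + cA + cB + cV)
    (hA : (r1 + ma) • (gb + gP + u) = r1 • (ga + gb + gP + u) + cA)
    (hB : (r1 + mb) • (ga + gP + u) = r1 • (ga + gb + gP + u) + cB) :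
    cV = mb • ga + ma • gb + mV • (gP + u) := by
  have hneg : ∀ x : M, -x = x := fun x => by
    rw [neg_eq_iff_add_eq_zero, h2]
  have e : cV = -(mb • ga) - ma • gb + mV • (gP + u) := by
    have eA : cA = (r1 + ma) • (gb + gP + u) - r1 • (ga + gb + gP + u) := by rw [hA]; abel
    have eB : cB = (r1 + mb) • (ga + gP + u) - r1 • (ga + gb + gP + u) := by rw [hB]; abel
    have eV : cV = (r1 + ma + mb + mV) • (gP + u) - r1 • (ga + gb + gP + u) - cA - cB := by rw [hP]; abel
    rw [eV, eA, eB]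
    module
  rw [e, sub_eq_add_neg, hneg, hneg]

/-! ### §2 PARITY LAW — odd parts of a cycle type -/

/-- The number of odd parts of a list of naturals has the parity of its sum: a permutation of `a` letters has
`#{odd cycles} ≡ a (mod 2)`.  With `Fix(2B,σ) = cyc σ + e(σ) − 1 = #odd + 2e − 1` this gives the PARITY LAW `m_a ≡ a − 1 (mod 2)` for the
`GL₂(3)`-signatures with one reflection slot.
research route conditional on HC_CM; not a corollary; Q11.4-sentence-2 already refuted in dim ≥ 3. [folklore] -/
theorem length_filter_odd_mod_two (l : List ℕ) : (l.filter (fun x => x % 2 = 1)).length % 2 = l.sum % 2 := by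
  induction l with
  | nil => simp
  | cons x t ih =>
    rw [List.sum_cons, List.filter_cons]
    by_cases hx : x % 2 = 1
    · simp only [hx, decide_true, ite_true, List.length_cons]
      omega
    · simp only [hx, decide_false]
      have hx0 : x % 2 = 0 := by omega
      simp only [Bool.false_eq_true, ite_false]
      omega

/-- `cyc + e − 1 = (#odd + e) + e − 1` has the parity of `#odd − 1`: the reflection-slot fixed count modulo 2.
research route conditional on HC_CM; not a corollary; Q11.4-sentence-2 already refuted in dim ≥ 3. [folklore] -/
theorem fix_reflection_slot_parity (odd e : ℕ) (h : 1 ≤ odd + e) : ((odd + e) + e - 1) % 2 = (odd + 1) % 2 := by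
  omega

/-! ### §3 THEOREM P — the bidegree inequalities -/

/-- **(L4′), linear step.** S12 (b) `b·μ ≤ S − 2 + 2g_X`, the rate form `S ≤ K/2` (every incompatible orbit saves at most half its cost:
reflections save `½` at cost `1`, the other classes of `GL₂(3)` at most `7/8` at cost `2`) and S12 (a) `K = (m_b + 6) + (1 + m_a) + 4 − 4g_X`
give `b·μ ≤ (m_a + m_b + 7)/2`.
research route conditional on HC_CM; not a corollary; Q11.4-sentence-2 already refuted in dim ≥ 3. [folklore] -/
theorem budget_rate_bound (bμ S K ma mb g : ℚ) (h1 : bμ ≤ S - 2 + 2 * g) (h2 : S ≤ K / 2)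
    (h3 : K = ma + mb + 11 - 4 * g) : bμ ≤ (ma + mb + 7) / 2 := by
  rw [h3] at h2; linarith

/-- **(L4′), the bidegree bound.** With `b ≥ 0`, `b·μ ≤ (m_a+m_b+7)/2` and `1 + m_a ≤ 12μ + ½` (the `λ ⊕ λ̄`-part of
`H¹(Y_R)` has dimension `4·r(Y_R) ≤ 2g(Y_R) = 48μ + 2`): `b·(m_a + ½) ≤ 6·(m_a + m_b + 7)`.
research route conditional on HC_CM; not a corollary; Q11.4-sentence-2 already refuted in dim ≥ 3. [folklore] -/
theorem bidegree_bound (b μ ma mb : ℚ) (hb : 0 ≤ b) (h1 : b * μ ≤ (ma + mb + 7) / 2)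
    (h2 : 1 + ma ≤ 12 * μ + 1 / 2) : b * (ma + 1 / 2) ≤ 6 * (ma + mb + 7) := by
  have h3 : ma + 1 / 2 ≤ 12 * μ := by linarith
  calc b * (ma + 1 / 2) ≤ b * (12 * μ) := mul_le_mul_of_nonneg_left h3 hb
    _ = 12 * (b * μ) := by ring
    _ ≤ 12 * ((ma + mb + 7) / 2) := by linarith
    _ = 6 * (ma + mb + 7) := by ring

/-- **`m_a = 1 ⟹ a ≤ 24`.** `m_a = 1` reads `a + (A₁ − U₁) = 2 + 2t₃ + 2t₈` with `t₃ ≤ ⌊a/3⌋`, `t₈ ≤ ⌊a/8⌋`, so `a ≤ 2 + 2⌊a/3⌋ + 2⌊a/8⌋`,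
which fails from `a = 25` on.
research route conditional on HC_CM; not a corollary; Q11.4-sentence-2 already refuted in dim ≥ 3. [folklore] -/
theorem side_le_24_of_m_eq_one (a : ℕ) (h : a ≤ 2 + 2 * (a / 3) + 2 * (a / 8)) : a ≤ 24 := by
  omega

/-- **`a ≤ 12(m_a + 1)`:** `m_a ≥ 2(a−1) − (a−1) − 2⌊a/3⌋ − 2⌊a/8⌋`, i.e. `a ≤ 1 + m_a + 2⌊a/3⌋ + 2⌊a/8⌋` forces `a ≤ 12 m_a + 12`.
research route conditional on HC_CM; not a corollary; Q11.4-sentence-2 already refuted in dim ≥ 3. [folklore] -/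
theorem side_le_of_m (a m : ℕ) (h : a ≤ 1 + m + 2 * (a / 3) + 2 * (a / 8)) : a ≤ 12 * m + 12 := by
  omega

/-- **Case (α) of THEOREM P.** Class `[b]` with `b ≥ 91`: `91(m_a + ½) ≤ 6(m_a+m_b+7)` and `a(m_b + ½) ≤ 6(m_a+m_b+7)` with `m_a ≥ 1`
force `a ≤ 8` (integer form: doubled).
research route conditional on HC_CM; not a corollary; Q11.4-sentence-2 already refuted in dim ≥ 3. [folklore] -/
theorem classB_case_a_le_8 (a ma mb : ℕ) (hma : 1 ≤ ma) (h1 : 91 * (2 * ma + 1) ≤ 12 * (ma + mb + 7))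
    (h2 : a * (2 * mb + 1) ≤ 12 * (ma + mb + 7)) : a ≤ 8 := by
  have hmb : 15 ≤ mb := by omega
  by_contra hc
  have ha : 9 ≤ a := by omega
  have h3 : 9 * (2 * mb + 1) ≤ a * (2 * mb + 1) := Nat.mul_le_mul_right _ ha
  have h4 : 170 * ma + 7 ≤ 12 * mb := by omega
  nlinarith

/-- **COROLLARY Z1, the arithmetic.** A block-irreducible relative piece has the class of its relative block size `a`, and `a` lies in the
reach set of its carrier (TABLE S12: `a ≤ 81` for `GL₂(3)`, `≤ 92` for `PSL₂(7)`/`G₂₄`, `≤ 16` for `PSL₂(11)`); the residual rows need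
`7·13 ∣ a`, `5·23 ∣ a`, `7·23 ∣ a`, `13·23 ∣ a` (`ℚ(√-2)`), `13·17 ∣ a` (`ℚ(√-7)`), `17 ∣ a` or `7·13 ∣ a` (`ℚ(√-11)`): impossible.
research route conditional on HC_CM; not a corollary; Q11.4-sentence-2 already refuted in dim ≥ 3. [folklore] -/
theorem no_residual_blocksize :
    (∀ a : ℕ, 0 < a → a ≤ 81 → ¬ (91 ∣ a) ∧ ¬ (115 ∣ a) ∧ ¬ (161 ∣ a) ∧ ¬ (299 ∣ a)) ∧
    (∀ a : ℕ, 0 < a → a ≤ 92 → ¬ (221 ∣ a)) ∧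
    (∀ a : ℕ, 0 < a → a ≤ 16 → ¬ (17 ∣ a) ∧ ¬ (91 ∣ a) ∧ ¬ (119 ∣ a) ∧ ¬ (221 ∣ a)) := by
  refine ⟨fun a h0 h81 => ⟨?_, ?_, ?_, ?_⟩, fun a h0 h92 => ?_, fun a h0 h16 => ⟨?_, ?_, ?_, ?_⟩⟩ <;> omega

/-! ### §4 The rows this concerns -/

/-- **Rows `W6.2.91 / 115 / 161 / 299`** — the `ℚ(√-2)` residual rows are exactly the classes with two inert odd primes among
`{5, 7, 13, 23}`: `-2` is a non-square modulo `5, 7, 13, 23` (inert) and a square modulo `3, 11, 17, 19` (split).  Their keys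
`[(-91 : ℚ)] ≠ split`, … are the tree's `sixfold_sqrtNeg2_neg91_ne_split` and companions (TableC), used by name.
research route conditional on HC_CM; not a corollary; Q11.4-sentence-2 already refuted in dim ≥ 3. [cite: Serre1973, Ch. III §1] -/
theorem sqrtNegTwo_inert_and_split_primes :
    (¬ IsSquare (-(2 : ZMod 5)) ∧ ¬ IsSquare (-(2 : ZMod 7)) ∧ ¬ IsSquare (-(2 : ZMod 13)) ∧ ¬ IsSquare (-(2 : ZMod 23))) ∧
    (IsSquare (-(2 : ZMod 3)) ∧ IsSquare (-(2 : ZMod 11)) ∧ IsSquare (-(2 : ZMod 17)) ∧ IsSquare (-(2 : ZMod 19))) := by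
  refine ⟨⟨by decide, by decide, by decide, by decide⟩, ⟨⟨1, by decide⟩, ⟨3, by decide⟩, ⟨7, by decide⟩, ⟨6, by decide⟩⟩⟩

end TowerLaw

end Summit.HodgeConjecture.HodgeConjecture.Ring2.WeilCoverage

end
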